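import Mathlib.Analysis.Calculus.ContDiff.Comp
import Literature.Geometry.Lorentzian.Basic
import HarnessLib

/-!
# Crux `HawkingExtensionIsKerr` (stmt-FinalStateConjecture-17840), line `SketchIdeator2` —
# programme HR (horizon regularity), brick HR-B: the `C^∞` bootstrap

Registered sub-goal `stub_hr_bootstrap` of the line skeleton.  Pure calculus: a continuous
function `u` on an open `D ⊆ ℝ³` whose graph lies in an open `Ω ⊆ ℝ³ × ℝ`, which is
differentiable at every point of `D` with derivative `Du(y) = G(y, u y)` for a field of linear
forms `G ∈ C^∞(Ω)`, is `C^∞` on `D`.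

Proof: `ContDiffOn ℝ ∞ u D ↔ ∀ n : ℕ, ContDiffOn ℝ n u D` (`contDiffOn_infty`), and the right-hand
side is proved by induction on `n`.  The case `n = 0` is the continuity hypothesis
(`contDiffOn_zero`).  For the step `n → n + 1` we use `contDiffOn_succ_iff_fderiv_of_isOpen`:
`u` is differentiable on `D`, the analyticity clause is vacuous (`(n : ℕ∞ω) ≠ ω`), and
`fderiv ℝ u = (y ↦ G (y, u y))` on `D` (`HasFDerivAt.fderiv`) is `C^n` on `D` as the composite of
`G` (`C^∞ ⊇ C^n` on `Ω`) with `y ↦ (y, u y)` (`C^n` by the induction hypothesis), which maps `D`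
into `Ω`.
-/

noncomputable section

set_option linter.dupNamespace false

namespace Summit.FinalStateConjecture.FinalStateConjecture.Theorems.HawkingExtensionIsKerr.SketchIdeator2

open Literature.Geometry.Lorentzian
open scoped Manifold ContDiff Topology

/-- **HR-B (bootstrap): a continuous function whose derivative is a smooth function of its graph
point is smooth** (`Du = G(·, u)`, `G ∈ C^∞` ⇒ `u ∈ C^∞`, by induction on the order). -/
theorem stub_hr_bootstrap : ∀ (u : E3 → ℝ) (G : E3 × ℝ → E3 →L[ℝ] ℝ) (D : Set E3) (Ω : Set (E3 × ℝ)), IsOpen D → IsOpen Ω → ContinuousOn u D → (∀ y ∈ D, (y, u y) ∈ Ω) → ContDiffOn ℝ ∞ G Ω → (∀ y ∈ D, HasFDerivAt u (G (y, u y)) y) → ContDiffOn ℝ ∞ u D := by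
  intro u G D Ω hD _hΩ hu hmem hG hderiv
  rw [contDiffOn_infty]
  intro n
  induction n with
  | zero =>
    rw [Nat.cast_zero, contDiffOn_zero]
    exact hu
  | succ n ih =>
    rw [show ((n + 1 : ℕ) : WithTop ℕ∞) = (n : WithTop ℕ∞) + 1 by push_cast; rfl,
      contDiffOn_succ_iff_fderiv_of_isOpen hD]
    refine ⟨fun y hy ↦ (hderiv y hy).differentiableAt.differentiableWithinAt, by simp, ?_⟩
    -- `y ↦ (y, u y)` is `C^n` on `D` and maps `D` into `Ω`
    have hgraph : ContDiffOn ℝ n (fun y : E3 ↦ (y, u y)) D := contDiffOn_id.prodMk ih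
    have hmaps : Set.MapsTo (fun y : E3 ↦ (y, u y)) D Ω := fun y hy ↦ hmem y hy
    -- `G` is `C^n` on `Ω`
    have hGn : ContDiffOn ℝ n G Ω := hG.of_le (by exact_mod_cast le_top)
    have hcomp : ContDiffOn ℝ n (fun y : E3 ↦ G (y, u y)) D := hGn.comp hgraph hmaps
    exact hcomp.congr fun y hy ↦ (hderiv y hy).fderiv

end Summit.FinalStateConjecture.FinalStateConjecture.Theorems.HawkingExtensionIsKerr.SketchIdeator2

end
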